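import Summits.ABC.StewartYu.PadicG3HalfSeparation
import Summits.ABC.StewartYu.FeldmanDirectionalWeights
import HarnessLib

/-!
# Cell abc-stewartyu, crux `Y07Odd` (stmt-ABC-19658), line `gen3-slab-odd`: the Kummer half-step, part 4 — DESCENT ALGEBRA: a vanishing class
# sum at the half points is a vanishing of the RE-INDEXED family `v = κ₀ + 2v′` at the odd integer points

`Summits/ABC/StewartYu/PadicG3HalfDescent.lean` — sequel to `PadicG3HalfSeparation` (cell `abc-stewartyu`, design HOME/p2/HALFSTEP-ODD.md; seat
p2-g4, F-odd lead).  Theorems on `G3Setup`; no named fact.  Place-free algebra of Nesterenko's step `(s, n) → (s+1, 0)` / Yu's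
(2.101)–(2.106) for the generic class family with RELATIVE exponents:

* `descent_dirMoments` — the triangular change of basis in the directional monomials: on a sub-family with `vᵢ = κ₀ + 2·vᵢ′`,
  `zγ(vᵢ)_k = zγ(κ₀)_k + 2·zγ(vᵢ′)_k`, so the identities `Σᵢ wᵢ ∏_k zγ(vᵢ)_k^{t_k} = 0` for all `|t| ≤ U` are EQUIVALENT to the same
  identities with `vᵢ′` (`DirWeights.dirMoment_eq_zero_of_triangular` with `P_k^{(j)} = (zγ(κ₀)_k + 2Y)^j`);
* the parity/exponent arithmetic at an odd point `s` for the natural root exponents `eᵢⱼ = vᵢⱼ·s + 2·L_j·|s|` of part 2/3: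
  `SsetG(eᵢ)` is the parity class `{j : vᵢⱼ odd}` (`SsetG_eq_of_odd`), and on the class `vᵢ = κ₀ + 2vᵢ′` (`κ₀ ∈ {0,1}ⁿ`) the rational
  part factors as `qEhG α eᵢ = (∏ⱼ αⱼ^{vᵢⱼ′ s}) · ∏ⱼ αⱼ^{L_j|s| + κ₀ⱼ(s−1)/2}` (`qEhG_eq_of_class`) — a monomial of the NEW family times a
  common nonzero factor.

WHAT THIS IS NOT: the glue `half-point class sums = 0 ⇒ g3φ R′ v′ B′ pv′ τ s = 0` with `R′ = R ∘ (X/2)` and the sign-twisted coefficients is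
part 5 (`PadicG3HalfStep`); no parameters; no crux moves.

References: Yu. V. Nesterenko, LNM 1819 (2003) §4.3, (3.25)/(3.30); K. Yu, Compositio 74 (1990) (2.101)–(2.106).
-/

noncomputable section

open Finset Polynomial
open Literature.NumberTheory.Transcendental
open scoped Nat

namespace Summit.ABC.StewartYu

namespace G3Setup

variable {p : ℕ} [Fact p.Prime] (S : G3Setup p) {ι : Type*} (v v' : ι → Fin S.n → ℤ) (κ₀ : Fin S.n → ℤ)

/-! ### The triangular change of basis `zγ(κ₀ + 2v′) = zγ(κ₀) + 2·zγ(v′)` -/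

/-- `zγ(κ₀ + 2v′)_k = zγ(κ₀)_k + 2·zγ(v′)_k`. [cite: Nesterenko2003, §4.3; shape only] -/
theorem zγ_reindex (w w' : Fin S.n → ℤ) (hw : w = κ₀ + (2 : ℤ) • w') (k : Fin S.n) :
    S.zγ w k = S.zγ κ₀ k + 2 * S.zγ w' k := by
  unfold zγ
  rw [hw, S.𝔛_add_smul]
  push_cast
  ring

/-- **The directional identities descend**: if `vᵢ = κ₀ + 2vᵢ′` on `B′` and `Σ_{i∈B′} wᵢ ∏_k zγ(vᵢ)_k^{t_k} = 0` for all `|t| ≤ U`, then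
`Σ_{i∈B′} wᵢ ∏_k zγ(vᵢ′)_k^{t_k} = 0` for all `|t| ≤ U` (triangular basis change, leading coefficients `2^{|t|} ≠ 0`; `2 • v′` is the `ℤ`-action).
[cite: Nesterenko2003, §4.3 with (3.25)/(3.30)] -/
theorem descent_dirMoments (B' : Finset ι) (hv : ∀ i ∈ B', v i = κ₀ + (2 : ℤ) • v' i) (w : ι → ℚ) (U : ℕ)
    (hzero : ∀ t : Fin S.n → ℕ, ∑ k, t k ≤ U → ∑ i ∈ B', w i * ∏ k, S.zγ (v i) k ^ t k = 0) :
    ∀ t : Fin S.n → ℕ, ∑ k, t k ≤ U → ∑ i ∈ B', w i * ∏ k, S.zγ (v' i) k ^ t k = 0 := by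
  classical
  -- the triangular family `P_k^{(j)} = (zγ(κ₀)_k + 2·Y)^j`
  set P : Fin S.n → ℕ → ℚ[X] := fun k j => (C (S.zγ κ₀ k) + C (2 : ℚ) * X) ^ j with hP
  have hdeg1 : ∀ k, (C (S.zγ κ₀ k) + C (2 : ℚ) * X).natDegree ≤ 1 := fun k =>
    (natDegree_add_le _ _).trans (max_le (by rw [natDegree_C]; exact Nat.zero_le _)
      ((natDegree_C_mul_le _ _).trans natDegree_X_le))
  have hc1 : ∀ k, (C (S.zγ κ₀ k) + C (2 : ℚ) * X).coeff 1 = 2 := fun k => by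
    rw [coeff_add, coeff_C, if_neg one_ne_zero, coeff_C_mul, coeff_X_one, mul_one, zero_add]
  have hdeg : ∀ k j, (P k j).natDegree ≤ j := fun k j => by
    simp only [hP]
    simpa only [mul_one] using natDegree_pow_le_of_le j (hdeg1 k)
  have hlead : ∀ k j, (P k j).coeff j ≠ 0 := fun k j => by
    simp only [hP]
    have h := coeff_pow_of_natDegree_le (hdeg1 k) (m := j)
    rw [mul_one] at h
    rw [h, hc1]
    exact pow_ne_zero _ two_ne_zero
  have hmom := DirWeights.dirMoment_eq_zero_of_triangular B' w (fun i k => S.zγ (v' i) k) U P hdeg hlead ?_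
  · intro t ht
    have := hmom t ht
    unfold DirWeights.dirMoment at this
    exact this
  · intro j hj
    have h := hzero j hj
    rw [← h]
    refine sum_congr rfl fun i hi => ?_
    congr 1
    refine prod_congr rfl fun k _ => ?_
    simp only [hP, eval_pow, eval_add, eval_C, eval_mul, eval_X]
    rw [S.zγ_reindex κ₀ (v i) (v' i) (hv i hi) k]

/-! ### Parity and rational parts of the root exponents `eᵢⱼ = vᵢⱼ s + 2 L_j |s|` -/

/-- The natural root exponents at the odd point `s`: `eᵢⱼ = vᵢⱼ·s + 2·L_j·|s|` (natural when `|vᵢⱼ| ≤ L_j`). [folklore] -/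
def rootExp (L : Fin S.n → ℕ) (w : Fin S.n → ℤ) (s : ℤ) : Fin S.n → ℕ := fun j => (w j * s + 2 * (L j * |s|)).toNat

/-- In the box `|wⱼ| ≤ L_j` the defining integer is nonnegative, so `(rootExp j : ℤ) = wⱼ s + 2 L_j |s|`. [folklore] -/
theorem rootExp_cast {L : Fin S.n → ℕ} {w : Fin S.n → ℤ} (hw : ∀ j, |w j| ≤ (L j : ℤ)) (s : ℤ) (j : Fin S.n) :
    ((S.rootExp L w s j : ℕ) : ℤ) = w j * s + 2 * (L j * |s|) := by
  unfold rootExp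
  refine Int.toNat_of_nonneg ?_
  have h1 : |w j * s| ≤ L j * |s| := by rw [abs_mul]; exact mul_le_mul_of_nonneg_right (hw j) (abs_nonneg _)
  have h2 : -(L j * |s|) ≤ w j * s := (abs_le.mp h1).1
  nlinarith [abs_nonneg s]

/-- **The root monomial with the natural exponents**: `∏ⱼ sq_j^{wⱼ s} = U · ∏ⱼ sq_j^{eⱼ}` with the unit `U = ∏ⱼ ω_j^{−L_j|s|}`.
[folklore] -/
theorem prod_sq_zpow_eq_unit_mul {L : Fin S.n → ℕ} {w : Fin S.n → ℤ} (hw : ∀ j, |w j| ≤ (L j : ℤ)) (s : ℤ) :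
    ∏ j, S.sq j ^ (w j * s) = (∏ j, S.ω j ^ (-((L j : ℤ) * |s|))) * ∏ j, S.sq j ^ (S.rootExp L w s j) := by
  rw [← prod_mul_distrib]
  refine prod_congr rfl fun j _ => ?_
  rw [← zpow_natCast, S.rootExp_cast hw s j, ← S.sq_sq j, ← zpow_natCast, ← zpow_mul, ← zpow_add₀ (S.sq_ne j)]
  congr 1
  push_cast
  ring

/-- The unit has norm one. [folklore] -/
theorem norm_unit_eq_one (L : Fin S.n → ℕ) (s : ℤ) : ‖∏ j, S.ω j ^ (-((L j : ℤ) * |s|))‖ = 1 := by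
  rw [norm_prod]
  exact prod_eq_one fun j _ => by rw [norm_zpow, S.norm_ω, one_zpow]

/-- **At an odd point the parity set of the root exponents is the parity class of `v`**: `SsetG(eᵢ) = {j : vᵢⱼ odd}`. [folklore] -/
theorem SsetG_rootExp_of_odd {L : Fin S.n → ℕ} {w : Fin S.n → ℤ} (hw : ∀ j, |w j| ≤ (L j : ℤ)) {s : ℤ} (hs : Odd s) :
    HalfMono.SsetG (S.rootExp L w s) = univ.filter fun j => Odd (w j) := by
  unfold HalfMono.SsetG
  refine Finset.filter_congr fun j _ => ?_
  have hc := S.rootExp_cast hw s j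
  constructor
  · intro h
    have hodd : Odd ((S.rootExp L w s j : ℕ) : ℤ) := by exact_mod_cast Nat.odd_iff.mpr h
    rw [hc] at hodd
    have h2 : Odd (w j * s) := by
      have : w j * s = (w j * s + 2 * (L j * |s|)) - 2 * (L j * |s|) := by ring
      rw [this]; exact hodd.sub_even (even_two_mul _)
    exact (Int.odd_mul.mp h2).1
  · intro hwj
    have h2 : Odd (w j * s + 2 * (L j * |s|)) := (Int.odd_mul.mpr ⟨hwj, hs⟩).add_even (even_two_mul _)
    rw [← hc] at h2
    exact Nat.odd_iff.mp (by exact_mod_cast h2)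

/-- **The rational part on a class**: if `w = κ₀ + 2w′` with `κ₀ⱼ ∈ {0,1}`, `|wⱼ| ≤ L_j`, `s` odd, then
`qEhG α (rootExp L w s) = (∏ⱼ αⱼ^{wⱼ′ s}) · ∏ⱼ αⱼ^{L_j|s| + κ₀ⱼ(s−1)/2}`. [cite: Yu1990, (2.103); shape only] -/
theorem qEhG_rootExp_of_class {L : Fin S.n → ℕ} {w w' : Fin S.n → ℤ} (hw : ∀ j, |w j| ≤ (L j : ℤ))
    (hκ : ∀ j, κ₀ j = 0 ∨ κ₀ j = 1) (hww : w = κ₀ + (2 : ℤ) • w') {s : ℤ} (hs : Odd s) :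
    HalfMono.qEhG S.α (S.rootExp L w s) =
      (∏ j, S.α j ^ (w' j * s)) * ∏ j, S.α j ^ ((L j : ℤ) * |s| + κ₀ j * ((s - 1) / 2)) := by
  unfold HalfMono.qEhG
  rw [← prod_mul_distrib]
  refine prod_congr rfl fun j _ => ?_
  rw [← zpow_natCast, ← zpow_add₀ (S.α_ne j)]
  congr 1
  -- `⌊eⱼ/2⌋ = wⱼ′ s + L_j|s| + κ₀ⱼ(s−1)/2`
  obtain ⟨m, hm⟩ := hs
  have hc := S.rootExp_cast hw s j
  have hwj : w j = κ₀ j + 2 * w' j := by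
    rw [hww]; simp only [Pi.add_apply, Pi.smul_apply, smul_eq_mul]
  have hs1 : (s - 1) / 2 = m := by omega
  rw [hs1]
  generalize hP : (L j : ℤ) * |s| = P at hc ⊢
  have hQ' : w j * s = κ₀ j * s + 2 * (w' j * s) := by rw [hwj]; ring
  rw [hQ'] at hc
  generalize hQ : w' j * s = Q at hc ⊢
  rcases hκ j with h0 | h1
  · rw [h0] at hc ⊢
    have h2 : ((S.rootExp L w s j : ℕ) : ℤ) = 2 * (Q + P) := by rw [hc]; ring
    omega
  · rw [h1] at hc ⊢
    have h2 : ((S.rootExp L w s j : ℕ) : ℤ) = 2 * (Q + P + m) + 1 := by rw [hc, hm]; ring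
    omega

/-- **The directional identities under an affine change of the directional scalars** (general shift): if
`zγ(vᵢ)_k = a_k + c·zγ(vᵢ′)_k` on `B′` with `c ≠ 0` (halving: `a = zγ(κ₀)`, `c = 2`; re-basing to a new base point: `a = zγ(v_{i₁}′)`, `c = 1`),
then the vanishing of `Σ_{i∈B′} wᵢ ∏_k zγ(vᵢ)_k^{t_k}` for all `|t| ≤ U` implies the same for `vᵢ′`. [cite: Nesterenko2003, §4.3 with (3.25)/(3.30)] -/
theorem descent_dirMoments_shift (B' : Finset ι) (a : Fin S.n → ℚ) {c : ℚ} (hc : c ≠ 0)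
    (hv : ∀ i ∈ B', ∀ k, S.zγ (v i) k = a k + c * S.zγ (v' i) k) (w : ι → ℚ) (U : ℕ)
    (hzero : ∀ t : Fin S.n → ℕ, ∑ k, t k ≤ U → ∑ i ∈ B', w i * ∏ k, S.zγ (v i) k ^ t k = 0) :
    ∀ t : Fin S.n → ℕ, ∑ k, t k ≤ U → ∑ i ∈ B', w i * ∏ k, S.zγ (v' i) k ^ t k = 0 := by
  classical
  set P : Fin S.n → ℕ → ℚ[X] := fun k j => (C (a k) + C c * X) ^ j with hP
  have hdeg1 : ∀ k, (C (a k) + C c * X).natDegree ≤ 1 := fun k =>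
    (natDegree_add_le _ _).trans (max_le (by rw [natDegree_C]; exact Nat.zero_le _)
      ((natDegree_C_mul_le _ _).trans natDegree_X_le))
  have hc1 : ∀ k, (C (a k) + C c * X).coeff 1 = c := fun k => by
    rw [coeff_add, coeff_C, if_neg one_ne_zero, coeff_C_mul, coeff_X_one, mul_one, zero_add]
  have hdeg : ∀ k j, (P k j).natDegree ≤ j := fun k j => by
    simp only [hP]
    simpa only [mul_one] using natDegree_pow_le_of_le j (hdeg1 k)
  have hlead : ∀ k j, (P k j).coeff j ≠ 0 := fun k j => by
    simp only [hP]
    have h := coeff_pow_of_natDegree_le (hdeg1 k) (m := j)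
    rw [mul_one] at h
    rw [h, hc1]
    exact pow_ne_zero _ hc
  have hmom := DirWeights.dirMoment_eq_zero_of_triangular B' w (fun i k => S.zγ (v' i) k) U P hdeg hlead ?_
  · intro t ht
    have := hmom t ht
    unfold DirWeights.dirMoment at this
    exact this
  · intro j hj
    have h := hzero j hj
    rw [← h]
    refine sum_congr rfl fun i hi => ?_
    congr 1
    refine prod_congr rfl fun k _ => ?_
    simp only [hP, eval_pow, eval_add, eval_C, eval_mul, eval_X]
    rw [hv i hi k]

/-- Re-basing: `zγ(v)_k = zγ(v − w)_k + 1·zγ(w)_k`… precisely `zγ(u + w)_k = zγ(u)_k + zγ(w)_k`. [folklore] -/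
theorem zγ_add (u w : Fin S.n → ℤ) (k : Fin S.n) : S.zγ (u + w) k = S.zγ u k + S.zγ w k := by
  unfold zγ
  rw [S.𝔛_add]
  push_cast
  ring

end G3Setup

end Summit.ABC.StewartYu

end
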